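import Summits.QuantumFields.BalabanUV.T4Continuum.Support.NE7K1LinTorusLineFourier
import Summits.QuantumFields.BalabanUV.T4Continuum.Support.NE7K1LinBlochSymbolTorus

/-!
# NE7K1LinTorusLineEngine — row NE7 (node U5), candidate route HOM, path H1L, cell K1-lin(s): NEEDS-ESTIMATE #E1, B-E1 DOCKED
# TO THE ENGINE — the doubled-torus two-cutoff line IS `n²·MultiPeriod.torusKernel` OF THE DESCENDED STRIP-REGULAR MULTIPLIER
# `(1−s)Δ¹ + s·k_L` (the object of `B4TorusKernel.MultiPeriod.torusKernel_descend_eq ∕ _decay`)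

Lineage `b2b-balaban-t4-ne7-p2` (CRUX PROVER NE7 #2), generation 75; file 61.  File 60 (`NE7K1LinTorusLineFourier`) wrote the
torus line as an inverse DFT over the RAW representatives `boxDom P`; the engine `B4TorusKernel.MultiPeriod` samples a descended
multiplier at the grid points `k∕N` read through the CENTRED representative `rep`.  THIS FILE does the bookkeeping between the two:

* §1 `mFourier_gridPt_eq_chiT` (the engine's grid character IS `chiT`), `sum_boxDom_eq_sum_grid` (re-indexing `boxDom P` by the grid
  `Π_μ Fin P_μ`), `card_boxDom`.
* §2 the CENTRED INTEGER REPRESENTATIVE `cRep P k` of a grid index (`k_μ` or `k_μ − P_μ`), `rep_grid_eq` (`rep(k_μ∕P_μ) = cRep_μ∕P_μ`),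
  `abs_cRep_lt`, and **`torSymb_cRep_eq`**: the symbol at the centred and at the raw representative agree (`torSymb` is `P`-periodic in
  the dual index, `chiT_add_left` + integer phases) — hence, by THEOREM I on both sides, SO DO THE SAMPLES of `n²[(1−s)Δ¹ + s·k_L]`
  (`lineSample_cRep_eq`; no periodicity lemma for `k_L` is needed).
* §3 **`torLineRep_eq_torusKernel`**: for `0 ≤ s ≤ 1`, every mesh `n ≥ 1`, `L ≥ 1`, torus `M`, representatives `x, y`:
  `(T^𝕋(s)(x, y) : ℂ) = n²·MultiPeriod.torusKernel (descendC ((1−s)Δ¹ + s·k_L) (line_stripRegular L hs0 hs1) _) (2nM) (x − y)`, and the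
  immediate corollaries BY NAME: **`torLineRep_eq_periodise`** (`= n²·Σ_m latticeKernel ((1−s)Δ¹ + s·k_L) (x − y + Pm)`,
  `torusKernel_descend_eq`) and **`norm_torLineRep_le_engine`** (`≤ n²·(16D∕c_N(D))·periodConst κ_N d·e^{−(κ_N∕(d+1))·torusSupNorm P (x−y)}`,
  `torusKernel_descend_decay_torusMetric`) — the engine's Poisson descent and uniform decay, read on the torus line of files 34–37.

HONEST FRAMING: [folklore] bookkeeping (re-indexing, centred representatives) + the engine `B4TorusKernel` and files 48∕59∕60 BY NAME;
no new estimate (the decay corollary is the engine's generic bound with file 48's constants — files 42–44 already proved a sharper,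
Combes–Thomas decay of the torus line); `a = 0`; nothing of Bałaban's asserted; no `sorry`.  Census only (B-E1 docked to the engine;
#E1 OPEN = R-E1); NE7 NOT PRINTED ∕ NOT PROVED; spine 0∕9; FIXED FINITE T⁴, rung (B)+1; NOT infinite volume, NOT mass gap, NOT Clay.
HONEST DEPENDENCY: continuum YM on T⁴ ⇐ BetaPertH ∧ nine spine estimates (0/9 proved); BetaPertH ⇐ (D1) ∧ (D4) ∧ CAP+tail;
G-an2-4 gates asym, D1 and NE2/3/4.
-/

noncomputable section

open Finset Matrix Complex UnitAddTorus

namespace Summit.QuantumFields.BalabanUV.T4Continuum.NE7K1LinTorusLineEngine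

open Literature.MathematicalPhysics.QuantumFieldTheory.Balaban1983to89
open Literature.MathematicalPhysics.QuantumFieldTheory.Balaban1983to89.B4Reflection242
open Literature.MathematicalPhysics.QuantumFieldTheory.Balaban1983to89.B4Lower18
open Literature.MathematicalPhysics.QuantumFieldTheory.Balaban1983to89.B4TorusPositivity (wrap)
open Literature.MathematicalPhysics.QuantumFieldTheory.Balaban1983to89.B4Strip (Delta1 Delta1r ofRealVec Delta1_ofReal)
open Literature.MathematicalPhysics.QuantumFieldTheory.Balaban1983to89.B4ContourShift (StripRegular supNorm)
open Literature.MathematicalPhysics.QuantumFieldTheory.Balaban1983to89.B4TorusKernel (rep rep_coe descend descendC descendC_apply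
  periodConst)
open Literature.MathematicalPhysics.QuantumFieldTheory.Balaban1983to89.B4TorusKernel.MultiPeriod
open NE7K1LinFoldKernels NE7K1LinFoldMatrices NE7K1LinTorusLineSymbol NE7K1LinTorusSymbolReal NE7K1LinTorusFineWaves
open NE7K1LinTorusSymbolWindow NE7K1LinTorusSymbolBloch NE7K1LinTorusLineFourier NE7K1LinBlochDenominator NE7K1LinBlochSymbol
open scoped Real

variable {d : ℕ}

/-! ### §1 Grid characters are `chiT`; re-indexing `boxDom P` by the grid -/

/-- the engine's grid character is this lineage's `chiT`: `Π_μ e^{2πi z_μ k_μ∕P_μ} = χ_{k}(z)`. [folklore] -/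
theorem mFourier_gridPt_eq_chiT {P : Fin (d + 1) → ℕ} (hP : ∀ i, 1 ≤ P i) (z : Fin (d + 1) → ℤ)
    (k : (i : Fin (d + 1)) → Fin (P i)) :
    mFourier z (gridPt P k) = chiT P (fun i => ((k i : ℕ) : ℤ)) z := by
  rw [chiT_eq_prod]
  show (∏ i, fourier (z i) (gridPt P k i)) = _
  refine Finset.prod_congr rfl fun i _ => ?_
  have hPi : ((P i : ℕ) : ℂ) ≠ 0 := by have := hP i; exact_mod_cast (show P i ≠ 0 by omega)
  show fourier (z i) (((((k i : ℕ) : ℝ) / P i : ℝ)) : UnitAddCircle) = _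
  rw [fourier_coe_apply]
  congr 1
  push_cast
  field_simp

/-- the raw representatives are the grid, as integer vectors. [folklore] -/
theorem boxDom_eq_image_grid (P : Fin (d + 1) → ℕ) :
    boxDom P = (Finset.univ : Finset ((i : Fin (d + 1)) → Fin (P i))).image (fun k => fun i => ((k i : ℕ) : ℤ)) := by
  classical
  ext p
  rw [mem_boxDom, Finset.mem_image]
  constructor
  · intro h
    refine ⟨fun i => ⟨(p i).toNat, ?_⟩, Finset.mem_univ _, ?_⟩
    · have := h i; omega
    · funext i; dsimp only; exact Int.toNat_of_nonneg (h i).1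
  · rintro ⟨k, -, rfl⟩ i
    dsimp only
    exact ⟨by positivity, by exact_mod_cast (k i).2⟩

/-- re-indexing the raw representatives by the grid: `Σ_{p ∈ boxDom P} F p = Σ_{k ∈ Π_μ Fin P_μ} F (k as integers)`. [folklore] -/
theorem sum_boxDom_eq_sum_grid (P : Fin (d + 1) → ℕ) (F : (Fin (d + 1) → ℤ) → ℂ) :
    ∑ p ∈ boxDom P, F p = ∑ k : (i : Fin (d + 1)) → Fin (P i), F (fun i => ((k i : ℕ) : ℤ)) := by
  classical
  rw [boxDom_eq_image_grid, Finset.sum_image]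
  intro k _ k' _ h
  funext i
  have := congrFun h i
  dsimp only at this
  exact Fin.ext (by exact_mod_cast this)

/-- `|boxDom P| = Π_μ P_μ`. [folklore] -/
theorem card_boxDom (P : Fin (d + 1) → ℕ) : ((boxDom P).card : ℂ) = ∏ i, ((P i : ℕ) : ℂ) := by
  classical
  rw [boxDom, Fintype.card_piFinset]
  push_cast
  refine Finset.prod_congr rfl fun i _ => ?_
  rw [Int.card_Ico, sub_zero, Int.toNat_natCast]

/-! ### §2 The centred integer representative of a grid index; the symbol at the two representatives -/

/-- THE CENTRED INTEGER REPRESENTATIVE of a grid index: `k_μ` if `2k_μ < P_μ`, else `k_μ − P_μ`. [folklore] -/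
def cRep (P : Fin (d + 1) → ℕ) (k : (i : Fin (d + 1)) → Fin (P i)) : Fin (d + 1) → ℤ :=
  fun i => if 2 * (k i : ℕ) < P i then ((k i : ℕ) : ℤ) else ((k i : ℕ) : ℤ) - (P i : ℤ)

/-- `|cRep_μ| < P_μ` (indeed `2|cRep_μ| ≤ P_μ`). [folklore] -/
theorem abs_cRep_lt (P : Fin (d + 1) → ℕ) (k : (i : Fin (d + 1)) → Fin (P i)) (i : Fin (d + 1)) :
    |cRep P k i| < (P i : ℤ) := by
  have hk := (k i).2
  unfold cRep
  split_ifs with h <;> rw [abs_lt] <;> constructor <;> omega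

/-- `2|cRep_μ| ≤ P_μ`. [folklore] -/
theorem two_abs_cRep_le (P : Fin (d + 1) → ℕ) (k : (i : Fin (d + 1)) → Fin (P i)) (i : Fin (d + 1)) :
    2 * |cRep P k i| ≤ (P i : ℤ) := by
  have hk := (k i).2
  unfold cRep
  split_ifs with h
  · rw [abs_of_nonneg (by positivity)]; omega
  · rw [abs_of_nonpos (by omega)]; omega

/-- the centred and the raw representatives differ by a period vector: `cRep = k − P∘ε`, `ε_μ ∈ {0,1}`. [folklore] -/
theorem cRep_eq_sub (P : Fin (d + 1) → ℕ) (k : (i : Fin (d + 1)) → Fin (P i)) :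
    cRep P k = (fun i => ((k i : ℕ) : ℤ)) - fun i => (P i : ℤ) * (if 2 * (k i : ℕ) < P i then 0 else 1) := by
  funext i
  simp only [cRep, Pi.sub_apply]
  split_ifs <;> ring

/-- **THE ENGINE's CENTRED MOMENTUM IS `θ(cRep)`**: `2π·rep(k_μ∕P_μ) = 2π·cRep_μ∕P_μ`. [folklore] -/
theorem rep_grid_eq {P : Fin (d + 1) → ℕ} (hP : ∀ i, 1 ≤ P i) (k : (i : Fin (d + 1)) → Fin (P i)) (i : Fin (d + 1)) :
    2 * π * rep (gridPt P k i) = thetaOf P (cRep P k) i := by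
  have hPi : (0 : ℝ) < P i := by exact_mod_cast hP i
  have hk : ((k i : ℕ) : ℝ) < P i := by exact_mod_cast (k i).2
  show 2 * π * rep (((((k i : ℕ) : ℝ) / P i : ℝ)) : UnitAddCircle) = 2 * π * (cRep P k i : ℝ) / P i
  unfold cRep
  split_ifs with h
  · have h' : 2 * ((k i : ℕ) : ℝ) < P i := by exact_mod_cast h
    have h0 : (0 : ℝ) ≤ ((k i : ℕ) : ℝ) / P i := by positivity
    rw [rep_coe ⟨by linarith, by rw [div_lt_iff₀ hPi]; linarith⟩]
    push_cast
    ring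
  · have h' : (P i : ℝ) ≤ 2 * ((k i : ℕ) : ℝ) := by exact_mod_cast (not_lt.1 h)
    have e : (((((k i : ℕ) : ℝ) / P i : ℝ)) : UnitAddCircle) = ((((k i : ℕ) : ℝ) / P i - 1 : ℝ) : UnitAddCircle) := by
      rw [← AddCircle.coe_add_period (1 : ℝ) (((k i : ℕ) : ℝ) / P i - 1), sub_add_cancel]
    rw [e, rep_coe ⟨by rw [le_sub_iff_add_le, le_div_iff₀ hPi]; linarith, by rw [sub_lt_iff_lt_add, div_lt_iff₀ hPi]; linarith⟩]
    push_cast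
    field_simp

/-- characters are symmetric in (dual index, point). [folklore] -/
theorem chiT_comm (P : Fin (d + 1) → ℕ) (p y : Fin (d + 1) → ℤ) : chiT P p y = chiT P y p := by
  unfold chiT
  simp_rw [mul_comm (p _) (y _)]

/-- characters are `P`-periodic in the DUAL index. [folklore] -/
theorem chiT_sub_period_left {P : Fin (d + 1) → ℕ} (hP : ∀ i, 1 ≤ P i) (p m y : Fin (d + 1) → ℤ) :
    chiT P (p - fun μ => (P μ : ℤ) * m μ) y = chiT P p y := by
  have h1 : chiT P (fun μ => (P μ : ℤ) * m μ) y = 1 := by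
    rw [chiT_comm, ← zero_add (fun μ => (P μ : ℤ) * m μ), chiT_period hP y 0 m, chiT_zero_right]
  have h2 := chiT_add_left P (p - fun μ => (P μ : ℤ) * m μ) (fun μ => (P μ : ℤ) * m μ) y
  rw [sub_add_cancel, h1, mul_one] at h2
  exact h2.symm

section Torus

variable {n L : ℕ} [NeZero L] {M : Fin (d + 1) → ℕ}

/-- **THE SYMBOL IS `P`-PERIODIC IN THE DUAL INDEX**: `σ_s(p − P∘m) = σ_s(p)`. [folklore] -/
theorem torSymb_sub_period (hn : 1 ≤ n) (hM : ∀ i, 1 ≤ M i) (s : ℝ) (y₀ : ↥(boxDom (dbl fun i => n * M i)))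
    (p m : Fin (d + 1) → ℤ) :
    torSymb (L := L) hn M s y₀ (p - fun μ => (dbl (fun i => n * M i) μ : ℤ) * m μ) = torSymb (L := L) hn M s y₀ p := by
  unfold torSymb symbT
  simp_rw [chiT_sub_period_left (dbl_pos (mul_pos_side hn hM))]

/-- **THE SAMPLES AT THE TWO REPRESENTATIVES AGREE**: by THEOREM I (file 59) at `cRep k` and at `k`, and the periodicity of the
symbol, `n²[(1−s)Δ¹ + s·k_L](θ(cRep k)) = n²[(1−s)Δ¹ + s·k_L](θ(k))` — no periodicity lemma for `k_L` enters. [folklore] -/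
theorem lineSample_cRep_eq (hn : 1 ≤ n) (hM : ∀ i, 1 ≤ M i) (y₀ : ↥(boxDom (dbl fun i => n * M i))) (s : ℝ)
    (k : (i : Fin (d + 1)) → Fin (dbl (fun i => n * M i) i)) :
    (((n : ℝ) ^ 2 * ((1 - s) * Delta1r 0 (thetaOf (dbl fun i => n * M i) (cRep (dbl fun i => n * M i) k)) +
        s * kLr L (thetaOf (dbl fun i => n * M i) (cRep (dbl fun i => n * M i) k))) : ℝ) : ℂ) =
      (((n : ℝ) ^ 2 * ((1 - s) * Delta1r 0 (thetaOf (dbl fun i => n * M i) (fun i => ((k i : ℕ) : ℤ))) +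
        s * kLr L (thetaOf (dbl fun i => n * M i) (fun i => ((k i : ℕ) : ℤ)))) : ℝ) : ℂ) := by
  rw [← torSymb_eq_ofReal hn hM y₀ (fun μ => abs_cRep_lt _ k μ) s,
    ← torSymb_eq_ofReal hn hM y₀ (p := fun i => ((k i : ℕ) : ℤ))
      (fun μ => by rw [abs_lt]; constructor <;> [linarith [(k μ).2]; exact_mod_cast (k μ).2]) s,
    cRep_eq_sub, torSymb_sub_period hn hM s y₀]

/-! ### §3 The torus line is the engine's torus kernel of the descended multiplier -/

/-- the descended line multiplier at a grid point is the real sample at the centred momentum. [folklore] -/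
theorem descend_line_gridPt (hn : 1 ≤ n) (hM : ∀ i, 1 ≤ M i) (s : ℝ)
    (k : (i : Fin (d + 1)) → Fin (dbl (fun i => n * M i) i)) :
    descend (fun p => (1 - s : ℂ) * Delta1 0 p + (s : ℂ) * kL (d := d + 1) L p) (gridPt (dbl fun i => n * M i) k) =
      ((((1 - s) * Delta1r 0 (thetaOf (dbl fun i => n * M i) (cRep (dbl fun i => n * M i) k)) +
        s * kLr L (thetaOf (dbl fun i => n * M i) (cRep (dbl fun i => n * M i) k))) : ℝ) : ℂ) := by
  have hP := dbl_pos (mul_pos_side hn hM)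
  unfold descend
  have e : (ofRealVec fun i => 2 * π * rep (gridPt (dbl fun i => n * M i) k i)) =
      ofRealVec (thetaOf (dbl fun i => n * M i) (cRep (dbl fun i => n * M i) k)) := by
    funext i; simp only [ofRealVec, rep_grid_eq hP k i]
  simp only [e, Delta1_ofReal, kL_ofReal]
  push_cast
  ring

/-- **THE DOUBLED-TORUS TWO-CUTOFF LINE IS THE ENGINE's TORUS KERNEL OF THE DESCENDED STRIP-REGULAR MULTIPLIER**: for
`0 ≤ s ≤ 1`, every mesh `n ≥ 1`, `L ≥ 1`, torus `M` and representatives `x, y`,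
`T^𝕋(s)(x, y) = n²·MultiPeriod.torusKernel (descendC ((1−s)Δ¹ + s·k_L) (line_stripRegular L hs0 hs1) _) (2nM) (x − y)`. [folklore] -/
theorem torLineRep_eq_torusKernel (hn : 1 ≤ n) (hM : ∀ i, 1 ≤ M i) {s : ℝ} (hs0 : 0 ≤ s) (hs1 : s ≤ 1)
    (x y : ↥(boxDom (dbl fun i => n * M i))) :
    (torLineRep (L := L) hn M s x y : ℂ) = (n : ℂ) ^ 2 *
      torusKernel (descendC _ (line_stripRegular (d := d) L hs0 hs1) (kappaN_pos _).le) (dbl fun i => n * M i) (x.1 - y.1) := by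
  have hP := dbl_pos (mul_pos_side hn hM)
  rw [torLineRep_eq_inv_fourier hn hM s x y, torusKernel, torusSum, card_boxDom, sum_boxDom_eq_sum_grid, Finset.mul_sum,
    Finset.mul_sum, Finset.mul_sum]
  refine Finset.sum_congr rfl fun k _ => ?_
  rw [descendC_apply, descend_line_gridPt hn hM s k, mFourier_gridPt_eq_chiT hP, ← lineSample_cRep_eq hn hM x s k]
  push_cast
  ring

/-- **POISSON DESCENT OF THE LINE, BY NAME**: `T^𝕋(s)(x, y) = n²·Σ_{m ∈ ℤ^{d+1}} latticeKernel ((1−s)Δ¹ + s·k_L) (x − y + Pm)`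
(`MultiPeriod.torusKernel_descend_eq`). [folklore] -/
theorem torLineRep_eq_periodise (hn : 1 ≤ n) (hM : ∀ i, 1 ≤ M i) {s : ℝ} (hs0 : 0 ≤ s) (hs1 : s ≤ 1)
    (x y : ↥(boxDom (dbl fun i => n * M i))) :
    (torLineRep (L := L) hn M s x y : ℂ) = (n : ℂ) ^ 2 * ∑' m : Fin (d + 1) → ℤ,
      B4ContourShift.latticeKernel (fun p => (1 - s : ℂ) * Delta1 0 p + (s : ℂ) * kL (d := d + 1) L p)
        (translate (dbl fun i => n * M i) (x.1 - y.1) m) := by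
  rw [torLineRep_eq_torusKernel hn hM hs0 hs1 x y,
    torusKernel_descend_eq (line_stripRegular (d := d) L hs0 hs1) (kappaN_pos _) (dbl_pos (mul_pos_side hn hM))]

/-- **THE ENGINE's UNIFORM DECAY, READ ON THE TORUS LINE**: `|T^𝕋(s)(x, y)| ≤ n²·(16D∕c_N(D))·periodConst κ_N(D) d·
e^{−(κ_N(D)∕(d+1))·torusSupNorm P (x − y)}` for `0 ≤ s ≤ 1`, uniformly in the torus (`torusKernel_descend_decay_torusMetric` BY NAME;
files 42–44's Combes–Thomas decay is sharper — this is the dictionary check). [folklore] -/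
theorem norm_torLineRep_le_engine (hn : 1 ≤ n) (hM : ∀ i, 1 ≤ M i) {s : ℝ} (hs0 : 0 ≤ s) (hs1 : s ≤ 1)
    (x y : ↥(boxDom (dbl fun i => n * M i))) :
    |torLineRep (L := L) hn M s x y| ≤ (n : ℝ) ^ 2 * ((16 * (d + 1 : ℕ) / cN (d + 1)) * periodConst (kappaN (d + 1)) d *
      Real.exp (-(kappaN (d + 1) / (d + 1) * torusSupNorm (dbl fun i => n * M i) (x.1 - y.1)))) := by
  have h := torusKernel_descend_decay_torusMetric (line_stripRegular (d := d) L hs0 hs1) (kappaN_pos _)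
    (dbl_pos (mul_pos_side hn hM)) (x.1 - y.1)
  have e := torLineRep_eq_torusKernel (L := L) hn hM hs0 hs1 x y
  have habs : |torLineRep (L := L) hn M s x y| = ‖(torLineRep (L := L) hn M s x y : ℂ)‖ := by
    rw [Complex.norm_real, Real.norm_eq_abs]
  rw [habs, e, norm_mul, norm_pow, Complex.norm_natCast]
  exact mul_le_mul_of_nonneg_left h (by positivity)

end Torus

end Summit.QuantumFields.BalabanUV.T4Continuum.NE7K1LinTorusLineEngine

end
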